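import Summits.CriticalPhenomena.CardyFormulaZ2.Theorems.CardyUSTContinuationKirchhoffExtremalLengthG02Beurling
import Summits.CriticalPhenomena.CardyFormulaZ2.Theorems.CardyUSTContinuationKirchhoffExtremalLengthG02Deriv
import Summits.CriticalPhenomena.CardyFormulaZ2.Theorems.CardyUSTContinuationKirchhoffExtremalLengthG02FatouExhaust

/-!
# `lim inf_{δ → 0⁺} 𝒞(A_δ ↔ B_δ; Ω_δ) ≥ d_Ω((ab),(cd))⁻¹` for the `meshDomain`/`discreteArc`
# discretisation of every conformal rectangle (the first half of `G02ModulusConvergence`)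

Support file for `KirchhoffExtremalLength` (route CardyUSTContinuation of `CardyFormulaZ2`, item
stmt-CriticalPhenomena-11234). The route item is equivalent to `G02ModulusConvergence`
(`…Reduction.lean`): the convergence, along all meshes `δ → 0⁺`, of the unit-conductance effective
conductance between the discrete arcs `A_δ`, `B_δ` of `(ab)`, `(cd)` in
`Ω_δ = discreteDomainGraph Ω δ` to the reciprocal extremal distance `d_Ω((ab),(cd))⁻¹`. This file
proves its lower half, for EVERY conformal rectangle and EVERY sequence of meshes `δ_n → 0⁺`:

* `inv_extremalDistance_le_of_subseq'`: if the conductances converge to `I` along `δ_n → 0⁺`,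
  then `d_Ω((ab),(cd))⁻¹ ≤ I`.

The proof is that of [GP19] Thm 4.1/4.6/Cor 4.15 (upper half `lim sup R^eff ≤ d`), as formalised
in the tree for the Georgakopoulos–Panagiotis discretisation along dyadic meshes
(`SquareTiling.inv_extremalDistance_le_of_subseq`), run on the G02 inputs of the companion files:
the potentials `h_n` (`…G02Potential`), their interior regularity and the local `C¹` structure of
subsequential limits (`…G02Interior`, `…G02Deriv`), Fatou along arbitrary meshes
(`…G02Fatou`, `…G02FatouExhaust`), boundary values by weak Beurling (`…G02NoCircuit`,
`…G02Beurling`), and the continuum step `SquareTiling.inv_extremalDistance_le` of the tree.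
-/

noncomputable section

namespace Summit.CriticalPhenomena.CardyFormulaZ2.Theorems

namespace KirchhoffSlope

open Set Metric Filter Topology MeasureTheory
open scoped ENNReal NNReal
open Literature.Probability.LatticeModels Literature.Probability.LatticeModels.SquareTiling
open Literature.Probability.RandomPlanarGeometry Literature.Analysis.Complex

open Classical in
/-- **`d_Ω((ab),(cd))⁻¹ ≤ lim 𝒞(A_δ ↔ B_δ; Ω_δ)` along any sequence of meshes `δ_n → 0⁺` at which
the discrete arcs are disjoint** (the core of the lower half of `G02ModulusConvergence`):
potentials, interior `C¹` compactness, Fatou, weak-Beurling boundary values, and Ahlfors' test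
metric `‖∇v‖`. [cite: GeorgakopoulosPanagiotis2019, Thm 4.1, Thm 4.6, Cor 4.15] -/
theorem inv_extremalDistance_le_of_subseq_of_disjoint (R : ConformalRectangle) {δs : ℕ → ℝ}
    (hδ : ∀ n, 0 < δs n) (hδ0 : Tendsto δs atTop (𝓝 0))
    (hdisj : ∀ n, discreteArc R.carrier (δs n) (R.arc 0) ∩ discreteArc R.carrier (δs n) (R.arc 2) = ∅)
    {I : ℝ≥0∞}
    (hI : Tendsto (fun n => effectiveConductance (discreteDomainGraph R.carrier (δs n)) 1
      (discreteArc R.carrier (δs n) (R.arc 0)) (discreteArc R.carrier (δs n) (R.arc 2))) atTop (𝓝 I)) :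
    (extremalDistance R.carrier (R.arc 0) (R.arc 2))⁻¹ ≤ I := by
  have hΩo : IsOpen R.carrier := R.isOpen
  -- the potentials `h_n`
  choose h hT hB h01 hE hharm using fun n => exists_g02Potential R (hδ n) (hdisj n)
  -- harmonicity on the boxes of every compact subset, eventually
  have hharmK : ∀ K ⊆ R.carrier, IsCompact K → ∀ᶠ n in atTop, ∀ (a : Site 2) (N : ℕ),
      Complex.Rectangle (meshPoint (δs n) a) (meshPoint (δs n) (a + ![(N : ℤ), (N : ℤ)])) ⊆ K →
        IsLatticeHarmonicOn (h n) (boxInterior a N) := by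
    intro K hK hKc
    obtain ⟨δ₁, hδ₁, H⟩ := exists_forall_isLatticeHarmonicOn_boxInterior R.toJordanDomain hKc hK
    filter_upwards [(tendsto_order.1 hδ0).2 _ hδ₁] with n hn a N hsq
    exact H _ (hδ n) hn _ _ (h n) (hharm n) a N hsq
  -- equi-Lipschitz bound in the bulk and diagonal extraction
  have hL := eventually_lipschitz_of_harmonicOnBoxes hΩo hδ hδ0 h01 hharmK
  obtain ⟨φ, hφ, ⟨I', hI'⟩, v, -, hvloc⟩ := exists_subseq_tendstoLocallyUniformly hΩo hδ hδ0 h01 hL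
    (fun n => effectiveConductance (discreteDomainGraph R.carrier (δs n)) 1
      (discreteArc R.carrier (δs n) (R.arc 0)) (discreteArc R.carrier (δs n) (R.arc 2)))
  obtain rfl : I = I' := tendsto_nhds_unique (hI.comp hφ.tendsto_atTop) hI'
  have hδ' : ∀ n, (0 : ℝ) < δs (φ n) := fun n => hδ (φ n)
  have hδ'0 : Tendsto (fun n => δs (φ n)) atTop (𝓝 0) := hδ0.comp hφ.tendsto_atTop
  have hharmK' : ∀ K ⊆ R.carrier, IsCompact K → ∀ᶠ n in atTop, ∀ (a : Site 2) (N : ℕ),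
      Complex.Rectangle (meshPoint (δs (φ n)) a) (meshPoint (δs (φ n)) (a + ![(N : ℤ), (N : ℤ)])) ⊆ K →
        IsLatticeHarmonicOn (h (φ n)) (boxInterior a N) :=
    fun K hK hKc => hφ.tendsto_atTop.eventually (hharmK K hK hKc)
  -- local `C¹` structure of `v`
  have hloc : ∀ z ∈ R.carrier, ∃ s > 0, ∃ g₀ g₁ : ℂ → ℝ, ContinuousOn g₀ (ball z s) ∧
      ContinuousOn g₁ (ball z s) ∧
      TendstoUniformlyOn
        (fun n w => (h (φ n) (nearestSite (δs (φ n)) w + Pi.single 0 1) -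
          h (φ n) (nearestSite (δs (φ n)) w)) / δs (φ n)) g₀ atTop (ball z s) ∧
      TendstoUniformlyOn
        (fun n w => (h (φ n) (nearestSite (δs (φ n)) w + Pi.single 1 1) -
          h (φ n) (nearestSite (δs (φ n)) w)) / δs (φ n)) g₁ atTop (ball z s) ∧
      ∀ w ∈ ball z s, HasFDerivAt v (g₀ w • Complex.reCLM + g₁ w • Complex.imCLM) w :=
    fun z hz => exists_local_hasFDerivAt_of_harmonicOnBoxes hΩo hδ' hδ'0 (H := fun n => h (φ n))
      (fun n => h01 (φ n)) hharmK' hvloc hz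
  choose s hs g₀ g₁ hg₀c hg₁c hg₀u hg₁u hF using hloc
  have hfd : ∀ z (hz : z ∈ R.carrier), ∀ w ∈ ball z (s z hz),
      fderiv ℝ v w = g₀ z hz w • Complex.reCLM + g₁ z hz w • Complex.imCLM :=
    fun z hz w hw => (hF z hz w hw).fderiv
  have hvd : ∀ w ∈ R.carrier, DifferentiableAt ℝ v w := fun w hw =>
    (hF w hw w (mem_ball_self (hs w hw))).differentiableAt
  have hvc : ContinuousOn (fderiv ℝ v) R.carrier := by
    intro z hz
    have hcont : ContinuousOn (fun w => g₀ z hz w • Complex.reCLM + g₁ z hz w • Complex.imCLM)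
        (ball z (s z hz)) :=
      ((hg₀c z hz).smul continuousOn_const).add ((hg₁c z hz).smul continuousOn_const)
    exact ((hcont.congr fun w hw => hfd z hz w hw).continuousAt
      (ball_mem_nhds z (hs z hz))).continuousWithinAt
  have hDi : ∀ i : Fin 2, ∀ z (hz : z ∈ R.carrier), TendstoUniformlyOn
      (fun n w => (h (φ n) (nearestSite (δs (φ n)) w + Pi.single i 1) -
        h (φ n) (nearestSite (δs (φ n)) w)) / δs (φ n))
      (fun w => fderiv ℝ v w (if i = 0 then (1 : ℂ) else Complex.I)) atTop (ball z (s z hz)) := by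
    refine Fin.forall_fin_two.2 ⟨fun z hz => ?_, fun z hz => ?_⟩
    · refine (hg₀u z hz).congr_right fun w hw => ?_
      simp only [Fin.isValue, ↓reduceIte]
      rw [hfd z hz w hw]
      simp
    · refine (hg₁u z hz).congr_right fun w hw => ?_
      simp only [Fin.isValue, one_ne_zero, ↓reduceIte]
      rw [hfd z hz w hw]
      simp
  have hD : ∀ i : Fin 2, TendstoLocallyUniformlyOn
      (fun n w => (h (φ n) (nearestSite (δs (φ n)) w + Pi.single i 1) -
        h (φ n) (nearestSite (δs (φ n)) w)) / δs (φ n))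
      (fun w => fderiv ℝ v w (if i = 0 then (1 : ℂ) else Complex.I)) atTop R.carrier :=
    fun i u hu z hz => ⟨ball z (s z hz), mem_nhdsWithin_of_mem_nhds (ball_mem_nhds z (hs z hz)),
      hDi i z hz u hu⟩
  -- all lattice edges of compact subsets are eventually present
  have hedges : ∀ K' ⊆ R.carrier, IsCompact K' → ∀ᶠ n in atTop, ∀ x : Site 2,
      meshPoint (δs (φ n)) x ∈ K' → ∀ i : Fin 2,
        s(x, x + (Pi.single i 1 : Site 2)) ∈ (discreteDomainGraph R.carrier (δs (φ n))).edgeSet :=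
    fun K' hK' hK'c => eventually_axisEdges_mem' R.toJordanDomain hδ' hδ'0 hK' hK'c
  have hC : ∀ n, networkEnergy (discreteDomainGraph R.carrier (δs (φ n))) 1 (h (φ n)) ≤
      effectiveConductance (discreteDomainGraph R.carrier (δs (φ n))) 1
        (discreteArc R.carrier (δs (φ n)) (R.arc 0)) (discreteArc R.carrier (δs (φ n)) (R.arc 2)) :=
    fun n => (hE (φ n)).le
  -- Fatou
  have hint : ∫⁻ w in R.carrier, ‖fderiv ℝ v w‖ₑ ^ 2 ≤ I :=
    lintegral_norm_fderiv_sq_le' hΩo R.isBounded hδ' hδ'0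
      (G := fun n => discreteDomainGraph R.carrier (δs (φ n))) (h := fun n => h (φ n)) hedges hC hI' hvc hD
  -- boundary values
  have hpt : ∀ w ∈ R.carrier,
      Tendsto (fun n => h (φ n) (nearestSite (δs (φ n)) w)) atTop (𝓝 (v w)) := by
    intro w hw
    obtain ⟨r, hr, -, hconv⟩ := hvloc w hw
    exact hconv.tendsto_at (mem_ball_self hr)
  have hnear : ∀ w : ℂ, ∀ r > (0 : ℝ), ∀ᶠ n in atTop,
      dist (meshPoint (δs (φ n)) (nearestSite (δs (φ n)) w)) w < r := by
    intro w r hr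
    filter_upwards [(tendsto_order.1 hδ'0).2 _ hr] with n hn
    exact (dist_meshPoint_nearestSite_le (hδ' n) w).trans_lt hn
  have hTb : ∀ t ∈ Ioo (R.mark 0) (R.nextMark 0), ∀ ε : ℝ, 0 < ε → ∃ r > 0, ∀ w ∈ R.carrier,
      dist w (R.boundary t) < r → 1 - ε ≤ v w := by
    intro t ht ε hε
    obtain ⟨r, hr, δ₀, hδ₀, Hb⟩ := exists_forall_one_sub_le' R 0 ht (R.arc 2) hε
    refine ⟨r / 2, by positivity, fun w hw hwd => ge_of_tendsto (hpt w hw) ?_⟩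
    filter_upwards [(tendsto_order.1 hδ'0).2 _ hδ₀, eventually_adj_nearestSite' R.toJordanDomain hδ' hδ'0 hw,
      hnear w (r / 2) (by positivity)] with n hn hadj hd
    refine Hb _ (hδ' n) hn (h (φ n)) (hT (φ n)) (h01 (φ n)) (hharm (φ n)) _ ?_ hadj
    rw [mem_ball]
    linarith [dist_triangle (meshPoint (δs (φ n)) (nearestSite (δs (φ n)) w)) w (R.boundary t)]
  have hBb : ∀ t ∈ Ioo (R.mark 2) (R.nextMark 2), ∀ ε : ℝ, 0 < ε → ∃ r > 0, ∀ w ∈ R.carrier,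
      dist w (R.boundary t) < r → v w ≤ ε := by
    intro t ht ε hε
    obtain ⟨r, hr, δ₀, hδ₀, Hb⟩ := exists_forall_one_sub_le' R 2 ht (R.arc 0) hε
    refine ⟨r / 2, by positivity, fun w hw hwd => le_of_tendsto (hpt w hw) ?_⟩
    filter_upwards [(tendsto_order.1 hδ'0).2 _ hδ₀, eventually_adj_nearestSite' R.toJordanDomain hδ' hδ'0 hw,
      hnear w (r / 2) (by positivity)] with n hn hadj hd
    have key := Hb _ (hδ' n) hn (fun x => 1 - h (φ n) x) (fun x hx => by simp [hB (φ n) hx])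
      (fun x => by
        have := h01 (φ n) x
        simp only [mem_Icc] at this ⊢
        constructor <;> linarith)
      (fun x hx2 hx0 => by
        have hsum := hharm (φ n) x hx0 hx2
        have : ∑ y ∈ ((zdGraph 2).neighborFinset x).filter
            (fun y => (discreteDomainGraph R.carrier (δs (φ n))).Adj x y),
            ((1 - h (φ n) y) - (1 - h (φ n) x)) =
            -∑ y ∈ ((zdGraph 2).neighborFinset x).filter
              (fun y => (discreteDomainGraph R.carrier (δs (φ n))).Adj x y),
              (h (φ n) y - h (φ n) x) := by
          rw [← Finset.sum_neg_distrib]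
          exact Finset.sum_congr rfl fun y _ => by ring
        rw [this, hsum, neg_zero])
      _ ?_ hadj
    · linarith
    · rw [mem_ball]
      linarith [dist_triangle (meshPoint (δs (φ n)) (nearestSite (δs (φ n)) w)) w (R.boundary t)]
  exact inv_extremalDistance_le R hvd hint hTb hBb

/-- **`d_Ω((ab),(cd))⁻¹ ≤ lim 𝒞(A_δ ↔ B_δ; Ω_δ)` along EVERY sequence of meshes `δ_n → 0⁺`** —
the lower half (`lim inf ≥`) of `G02ModulusConvergence` for every conformal rectangle: if the
effective conductances between the discrete arcs converge to `I`, then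
`d_Ω((ab),(cd))⁻¹ ≤ I`. (The discrete arcs are disjoint for small meshes,
`eventually_discreteArc_inter_eq_empty`, so the previous theorem applies to a tail of the
sequence.) [cite: GeorgakopoulosPanagiotis2019, Cor 4.15] -/
theorem inv_extremalDistance_le_of_subseq' (R : ConformalRectangle) {δs : ℕ → ℝ}
    (hδ : ∀ n, 0 < δs n) (hδ0 : Tendsto δs atTop (𝓝 0)) {I : ℝ≥0∞}
    (hI : Tendsto (fun n => effectiveConductance (discreteDomainGraph R.carrier (δs n)) 1
      (discreteArc R.carrier (δs n) (R.arc 0)) (discreteArc R.carrier (δs n) (R.arc 2))) atTop (𝓝 I)) :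
    (extremalDistance R.carrier (R.arc 0) (R.arc 2))⁻¹ ≤ I := by
  obtain ⟨δ₀, hδ₀, hdisj⟩ := Literature.Probability.Percolation.eventually_discreteArc_inter_eq_empty R
  obtain ⟨N₀, hN₀⟩ := eventually_atTop.1 ((tendsto_order.1 hδ0).2 _ hδ₀)
  have hshift : Tendsto (fun n => n + N₀) atTop atTop := tendsto_add_atTop_nat N₀
  exact inv_extremalDistance_le_of_subseq_of_disjoint R (δs := fun n => δs (n + N₀)) (fun n => hδ _)
    (hδ0.comp hshift) (fun n => hdisj _ (hδ _) (hN₀ _ (Nat.le_add_left _ _))) (hI.comp hshift)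

end KirchhoffSlope

end Summit.CriticalPhenomena.CardyFormulaZ2.Theorems
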